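import Summits.HubbardSuperconductivity.HubbardSuperconductivity.Theses.GibbsMajorant

/-!
# Route `GibbsMajorant`: the assembly item `Assembly` (stmt-HubbardSuperconductivity-15722)

`ThermalWindowMajorant → WindowInfraredBound → FloorOfCruxes → UniformLROGivesSummitMatrix →
HubbardSuperconductivity` is literally the type of the route's kernel-checked deciding theorem
`Theses.GibbsMajorant.closes`; this file records it under `Theorems/` so the item can be closed.
Pure logic; no definition is introduced.
-/

set_option linter.dupNamespace false

namespace Summit.HubbardSuperconductivity.HubbardSuperconductivity.Theorems.GibbsMajorant

/-- **Route GibbsMajorant's `Assembly` holds** (item `stmt-HubbardSuperconductivity-15722`):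
the composition `ThermalWindowMajorant → WindowInfraredBound → FloorOfCruxes →
UniformLROGivesSummitMatrix → HubbardSuperconductivity` is the route's deciding theorem `closes`. [folklore] -/
theorem assembly_proof :
    Summit.HubbardSuperconductivity.HubbardSuperconductivity.Theses.GibbsMajorant.Assembly :=
  fun h1 h2 hF hU =>
    Summit.HubbardSuperconductivity.HubbardSuperconductivity.Theses.GibbsMajorant.closes h1 h2 hF hU

end Summit.HubbardSuperconductivity.HubbardSuperconductivity.Theorems.GibbsMajorant
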